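import Mathlib
import HarnessLib
import Literature.NumberTheory.LFunctions.SecondSpacingLemma

/-!
# Primitive lattice points on a plane through the origin, in a thin sector (Robert–Sargos, Lemma 5)

Topic `Literature/NumberTheory/LFunctions`. Everything in this file is PROVED (no `sorry`, no named
facts). It supplies the arithmetic counting lemma used three times in the proof of the Diophantine
Theorem 2 of O. Robert, P. Sargos, *A fourth derivative test for exponential sums*, Compositio Math.
130 (2002), 275–292 (= arXiv:2307.03562), namely their Lemma 5 (which they take from Iwaniec–Mozzochi,
J. Number Theory 29 (1988), proof of Thm 14.1, and Huxley, *Area, Lattice Points and Exponential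
Sums*, Lemma 13.1.2; see also Watt 1990): for non-zero integers `a, b, c` with `gcd(a, b, c) = 1`,
`c > 0`, reals `V ≥ 1`, `α < β`, the number `𝒱` of triples of non-zero integers `(u, v, w)` with
`gcd(u, v, w) = 1`, `V ≤ v ≤ 2V`, `au + bv + cw = 0`, `α ≤ u/v ≤ β` satisfies
`𝒱 ≪ τ(c) + (β - α) V² σ(c)/c²`.

What is proved here is the following STRONGER and elementary form, which is all the Robert–Sargos
argument uses (there `τ(c)` and `σ(c)/c² ≤ τ(c)/c` are only ever bounded by `c^ε` and `c^{ε-1}`):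

* `Literature.NumberTheory.LFunctions.RobertSargos.card_primitive_solutions_le` — with `c ≠ 0`,
  `gcd(gcd(a, b), c) = 1`, `V > 0`, `α ≤ β`, every finite set of triples `(u, v, w) ∈ ℤ³` with `w ≠ 0`,
  `gcd(gcd(u, v), w) = 1`, `V ≤ v ≤ 2V`, `au + bv + cw = 0`, `α ≤ u/v ≤ β` has at most
  `1 + 4 (β - α) V² / |c|` elements.

Proof (half a page, self-contained): for two solutions, `a(uv' - u'v) = -c(wv' - w'v)` and
`b(uv' - u'v) = -c(uw' - u'w)`, so `c ∣ uv' - u'v` because `gcd(a, b, c) = 1`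
(`sub_mul_sub_dvd`); a primitive solution with `v > 0` is determined by its slope `u/v`
(`eq_of_slope_eq`); hence distinct solutions have slopes at mutual distance `≥ |c|/(vv') ≥ |c|/(4V²)`
inside `[α, β]`, and `Literature.NumberTheory.LFunctions.SecondSpacing.card_le_of_spacing` counts them.

## References

* O. Robert, P. Sargos, *A fourth derivative test for exponential sums*, Compositio Math. 130 (2002),
  275–292, doi:10.1023/A:1014363224308 (= arXiv:2307.03562), Lemma 5.
* M. N. Huxley, *Area, Lattice Points and Exponential Sums*, Clarendon Press 1996, Lemma 13.1.2.
-/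

namespace Literature.NumberTheory.LFunctions
namespace RobertSargos

open Finset

/-- If `au + bv + cw = 0` and `au' + bv' + cw' = 0` with `gcd(gcd(a,b),c) = 1`, then `c ∣ uv' - u'v`.
[cite: RobertSargos2002, Lemma 5] -/
theorem sub_mul_sub_dvd {a b c u v w u' v' w' : ℤ} (habc : Int.gcd (Int.gcd a b) c = 1)
    (h : a * u + b * v + c * w = 0) (h' : a * u' + b * v' + c * w' = 0) :
    c ∣ u * v' - u' * v := by
  set t := u * v' - u' * v with ht
  have ha : c ∣ a * t := by
    refine ⟨-(w * v' - w' * v), ?_⟩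
    have e1 : a * u = -(b * v) - c * w := by linarith
    have e2 : a * u' = -(b * v') - c * w' := by linarith
    calc a * t = (a * u) * v' - (a * u') * v := by rw [ht]; ring
      _ = (-(b * v) - c * w) * v' - (-(b * v') - c * w') * v := by rw [e1, e2]
      _ = c * -(w * v' - w' * v) := by ring
  have hb : c ∣ b * t := by
    refine ⟨-(u * w' - u' * w), ?_⟩
    have e1 : b * v = -(a * u) - c * w := by linarith
    have e2 : b * v' = -(a * u') - c * w' := by linarith
    calc b * t = u * (b * v') - u' * (b * v) := by rw [ht]; ring
      _ = u * (-(a * u') - c * w') - u' * (-(a * u) - c * w) := by rw [e1, e2]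
      _ = c * -(u * w' - u' * w) := by ring
  -- `c ∣ gcd(a t, b t) = gcd(a, b) |t|`
  have hg : c ∣ ((Int.gcd (a * t) (b * t) : ℕ) : ℤ) := Int.dvd_coe_gcd ha hb
  rw [Int.gcd_mul_right, Nat.cast_mul, Int.natCast_natAbs] at hg
  have hc1 : Int.gcd c (Int.gcd a b) = 1 := by rw [Int.gcd_comm]; exact habc
  have h2 : c ∣ |t| := Int.dvd_of_dvd_mul_right_of_gcd_one hg hc1
  exact (dvd_abs _ _).1 h2

/-- Two PRIMITIVE solutions `(u,v,w)`, `(u',v',w')` of `au + bv + cw = 0` (`c ≠ 0`) with `v, v' > 0`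
and the same slope, `uv' = u'v`, coincide. [cite: RobertSargos2002, Lemma 5] -/
theorem eq_of_slope_eq {a b c u v w u' v' w' : ℤ} (hc : c ≠ 0)
    (h : a * u + b * v + c * w = 0) (h' : a * u' + b * v' + c * w' = 0)
    (hv : 0 < v) (hv' : 0 < v') (hp : Int.gcd (Int.gcd u v) w = 1) (hp' : Int.gcd (Int.gcd u' v') w' = 1)
    (hs : u * v' = u' * v) : u = u' ∧ v = v' ∧ w = w' := by
  -- `v' • (u,v,w) = v • (u',v',w')`
  have hw : v' * w = v * w' := by
    have : c * (v' * w - v * w') = 0 := by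
      have e1 : c * w = -(a * u) - b * v := by linarith
      have e2 : c * w' = -(a * u') - b * v' := by linarith
      calc c * (v' * w - v * w') = v' * (c * w) - v * (c * w') := by ring
        _ = v' * (-(a * u) - b * v) - v * (-(a * u') - b * v') := by rw [e1, e2]
        _ = -(a * (u * v' - u' * v)) := by ring
        _ = 0 := by rw [hs]; ring
    have := (mul_eq_zero.1 this).resolve_left hc
    linarith
  -- gcd of `v' • p` is `v'`, gcd of `v • p'` is `v`
  have hg1 : Int.gcd (Int.gcd (v' * u) (v' * v)) (v' * w) = v'.natAbs := by
    rw [Int.gcd_mul_left, Nat.cast_mul, Int.natCast_natAbs, abs_of_pos hv', Int.gcd_mul_left, hp,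
      mul_one]
  have hg2 : Int.gcd (Int.gcd (v * u') (v * v')) (v * w') = v.natAbs := by
    rw [Int.gcd_mul_left, Nat.cast_mul, Int.natCast_natAbs, abs_of_pos hv, Int.gcd_mul_left, hp',
      mul_one]
  have heq : Int.gcd (Int.gcd (v' * u) (v' * v)) (v' * w) = Int.gcd (Int.gcd (v * u') (v * v')) (v * w') := by
    rw [show v' * u = v * u' by linarith, show v' * v = v * v' by ring, hw]
  rw [hg1, hg2] at heq
  have hvv : v' = v := by
    have h1 : (v'.natAbs : ℤ) = v.natAbs := by exact_mod_cast heq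
    rwa [Int.natAbs_of_nonneg hv'.le, Int.natAbs_of_nonneg hv.le] at h1
  subst hvv
  refine ⟨?_, rfl, ?_⟩
  · have := hs; exact mul_right_cancel₀ hv'.ne' (by linarith)
  · exact mul_left_cancel₀ hv'.ne' hw

/-- **Robert–Sargos, Lemma 5 (elementary strong form).** Let `a, b, c ∈ ℤ`, `c ≠ 0`,
`gcd(gcd(a,b),c) = 1`, `V > 0`, `α ≤ β`. Any finite set of triples `(u, v, w) ∈ ℤ³` with `w ≠ 0`,
`gcd(gcd(u,v),w) = 1`, `V ≤ v ≤ 2V`, `au + bv + cw = 0` and `α ≤ u/v ≤ β` has at most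
`1 + 4(β - α)V²/|c|` elements. (The printed Lemma 5 — Iwaniec–Mozzochi, Huxley Lemma 13.1.2 — bounds the
same count by `≪ τ(c) + (β - α)V² σ(c)/c²`, which is weaker.) The triple is encoded as `(u, (v, w))`.
[cite: RobertSargos2002, Lemma 5] -/
theorem card_primitive_solutions_le {a b c : ℤ} (hc : c ≠ 0) (habc : Int.gcd (Int.gcd a b) c = 1)
    {V : ℝ} (hV : 0 < V) {α β : ℝ} (hαβ : α ≤ β) (S : Finset (ℤ × ℤ × ℤ))
    (hS : ∀ p ∈ S, p.2.2 ≠ 0 ∧ Int.gcd (Int.gcd p.1 p.2.1) p.2.2 = 1 ∧ V ≤ (p.2.1 : ℝ) ∧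
      (p.2.1 : ℝ) ≤ 2 * V ∧ a * p.1 + b * p.2.1 + c * p.2.2 = 0 ∧
      α ≤ (p.1 : ℝ) / p.2.1 ∧ (p.1 : ℝ) / p.2.1 ≤ β) :
    (S.card : ℝ) ≤ 1 + 4 * (β - α) * V ^ 2 / |(c : ℝ)| := by
  classical
  -- positivity of `v`
  have hvpos : ∀ p ∈ S, (0 : ℤ) < p.2.1 := by
    intro p hp
    have := (hS p hp).2.2.1
    exact_mod_cast hV.trans_le this
  -- the slope map is injective on `S`
  set s : ℤ × ℤ × ℤ → ℝ := fun p => (p.1 : ℝ) / p.2.1 with hsdef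
  have hinj : Set.InjOn s S := by
    intro p hp p' hp' hpp
    obtain ⟨_, hg, _, _, he, _, _⟩ := hS p hp
    obtain ⟨_, hg', _, _, he', _, _⟩ := hS p' hp'
    have hv := hvpos p hp
    have hv' := hvpos p' hp'
    have hcross : p.1 * p'.2.1 = p'.1 * p.2.1 := by
      have h1 : (p.1 : ℝ) / p.2.1 = (p'.1 : ℝ) / p'.2.1 := hpp
      have hv0 : (p.2.1 : ℝ) ≠ 0 := by exact_mod_cast hv.ne'
      have hv0' : (p'.2.1 : ℝ) ≠ 0 := by exact_mod_cast hv'.ne'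
      rw [div_eq_div_iff hv0 hv0'] at h1
      exact_mod_cast h1
    obtain ⟨h1, h2, h3⟩ := eq_of_slope_eq hc he he' hv hv' hg hg' hcross
    exact Prod.ext h1 (Prod.ext h2 h3)
  have hcard : (S.image s).card = S.card := Finset.card_image_of_injOn hinj
  -- spacing of the slopes
  have hc' : (0 : ℝ) < |(c : ℝ)| := abs_pos.2 (by exact_mod_cast hc)
  set δ : ℝ := |(c : ℝ)| / (4 * V ^ 2) with hδ
  have hδpos : 0 < δ := by positivity
  have hsep : ∀ x ∈ S.image s, ∀ y ∈ S.image s, x ≠ y → δ ≤ |x - y| := by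
    intro x hx y hy hxy
    obtain ⟨p, hp, rfl⟩ := Finset.mem_image.1 hx
    obtain ⟨p', hp', rfl⟩ := Finset.mem_image.1 hy
    obtain ⟨_, hg, hVp, hp2, he, _, _⟩ := hS p hp
    obtain ⟨_, hg', hVp', hp2', he', _, _⟩ := hS p' hp'
    have hv := hvpos p hp
    have hv' := hvpos p' hp'
    have hvR : (0 : ℝ) < p.2.1 := by exact_mod_cast hv
    have hvR' : (0 : ℝ) < p'.2.1 := by exact_mod_cast hv'
    -- the cross difference is a non-zero multiple of `c`
    set t : ℤ := p.1 * p'.2.1 - p'.1 * p.2.1 with ht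
    have htne : t ≠ 0 := by
      intro h0
      apply hxy
      have hcross : p.1 * p'.2.1 = p'.1 * p.2.1 := by linarith
      obtain ⟨h1, h2, h3⟩ := eq_of_slope_eq hc he he' hv hv' hg hg' hcross
      simp only [hsdef, h1, h2]
    have hdvd : c ∣ t := sub_mul_sub_dvd habc he he'
    have htabs : |(c : ℝ)| ≤ |(t : ℝ)| := by
      have h2 : |c| ≤ |t| := Int.le_of_dvd (abs_pos.2 htne) ((abs_dvd_abs c t).2 hdvd)
      have h3 : ((|c| : ℤ) : ℝ) ≤ ((|t| : ℤ) : ℝ) := by exact_mod_cast h2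
      simpa [Int.cast_abs] using h3
    have hdiff : s p - s p' = (t : ℝ) / (p.2.1 * p'.2.1) := by
      simp only [hsdef, ht]
      push_cast
      rw [div_sub_div _ _ hvR.ne' hvR'.ne']
      ring
    rw [hdiff, abs_div, abs_of_pos (mul_pos hvR hvR')]
    rw [hδ, div_le_div_iff₀ (by positivity) (mul_pos hvR hvR')]
    have hvv : (p.2.1 : ℝ) * p'.2.1 ≤ 4 * V ^ 2 := by
      calc (p.2.1 : ℝ) * p'.2.1 ≤ (2 * V) * (2 * V) :=
            mul_le_mul hp2 hp2' hvR'.le (by positivity)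
        _ = 4 * V ^ 2 := by ring
    calc |(c : ℝ)| * (p.2.1 * p'.2.1) ≤ |(c : ℝ)| * (4 * V ^ 2) :=
          mul_le_mul_of_nonneg_left hvv hc'.le
      _ ≤ |(t : ℝ)| * (4 * V ^ 2) := mul_le_mul_of_nonneg_right htabs (by positivity)
  have hdiam : ∀ x ∈ S.image s, ∀ y ∈ S.image s, x - y ≤ β - α := by
    intro x hx y hy
    obtain ⟨p, hp, rfl⟩ := Finset.mem_image.1 hx
    obtain ⟨p', hp', rfl⟩ := Finset.mem_image.1 hy
    have h1 := (hS p hp).2.2.2.2.2.2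
    have h2 := (hS p' hp').2.2.2.2.2.1
    simp only [hsdef]
    linarith
  have key := SecondSpacing.card_le_of_spacing (S.image s) hδpos (sub_nonneg.2 hαβ) hsep hdiam
  rw [hcard] at key
  calc (S.card : ℝ) ≤ (β - α) / δ + 1 := key
    _ = 1 + 4 * (β - α) * V ^ 2 / |(c : ℝ)| := by
        rw [hδ]
        field_simp
        ring

end RobertSargos
end Literature.NumberTheory.LFunctions
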